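import Summits.CriticalPhenomena.Ising3D.TaylorQPolyCoeffList
import Summits.CriticalPhenomena.Ising3D.TaylorQSumMoments
import Literature.Analysis.ValidatedNumerics.TaylorModelContract
import Mathlib.Tactic.Linarith
import Mathlib.Tactic.Positivity
import Mathlib.Tactic.Ring
import HarnessLib

/-!
# The generic `(P, D)`-expansion of the two-variable kernel and the `(E, h_k)` form of every q-sum
(cell `pub-ising3x`, seat recog-1 gen 11; gate (g2): discharges the hypothesis `hK` of
`qSum_eq_sum_hMoment_of_kernel` / `qM_half_of_kernelExpansion` ONCE for all weights — CONE-LAYER §5 caveat (i))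

HONEST FRAMING: lottery ticket; floor = tightest certified 3D Ising CFT bounds; no exact-solution
claim without a proof.

`TaylorQSumMoments` turns a kernel expansion `K_c(u,v) = Σ κ_{m,k} (u+v-c)^m (u-v)^k` into the exact
`(E-c, h_k)`-polynomial form of the q-sum (odd `k` drop out), but left the expansion as a hypothesis to be
established "by ring arithmetic per functional". Here the expansion is COMPUTED generically: bivariate
coefficient lists (`eval2`, `add2`, `smul2`, `mul2`, `shift2` = `p(X+Y)`, `altY` = `Y ↦ -Y`, `finSum2`, all with
evaluation homomorphisms), the kernel in the variables `(P, D) = (u+v-c, u-v)` as such a list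
(`kernelPDRow`, `kernelPDL` over an index list / `kernelPD` over a `Finset`, `eval2_kernelPD`: `u = (P+c+D)/2`, `v = (P+c-D)/2`, so `p_a(u) = p̂_a(P+D)`, `p_b(v) = p̂_b(P-D)` with
`p̂ = affineR p ½ (c/2)`), the read-off of monomial coefficients (`eval2_eq_sum_pad`), and hence
**`evenKernel_eq_sum_PD`** (the `hK`-shaped identity with the explicit table `kernelPDCoeff c S s σ cc m k`;
list form `evenKernel_eq_sum_PDL` with `coeff2 (kernelPDL c l …)`) and **`qSum_eq_sum_hMoment_PD`** (`…_PDL`): for ALL `c, S, s, σ, cc, E, j`,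
`qSum c S s σ E j = Σ_{(m,k)} kernelPDCoeff … m (2k) · (E-cc)^m · hMoment k j`.
A reader/producer recomputes `kernelPDCoeff` by running the same list algorithm (the definitions ARE the
algorithm) in exact rational or interval arithmetic; the Lean side needs no per-certificate identity.
Elementary (finite sums, Horner evaluation). [folklore]
-/

namespace Summit.CriticalPhenomena.Ising3D

open Finset
open Literature.Analysis.ValidatedNumerics.PolyMP
open Literature.MathematicalPhysics.QuantumFieldTheory.ConformalBootstrap3D

/-! ### Bivariate coefficient lists (outer index = power of the second variable) -/

/-- Evaluation of a bivariate coefficient list: `Σ_k (Σ_m Q_k,m X^m) Y^k` (Horner in both). [folklore] -/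
noncomputable def eval2 (Q : List (List ℝ)) (X Y : ℝ) : ℝ := evalR (Q.map fun l => evalR l X) Y

/-- [folklore] -/
@[simp] theorem eval2_nil (X Y : ℝ) : eval2 [] X Y = 0 := rfl

/-- [folklore] -/
theorem eval2_cons (p : List ℝ) (Q : List (List ℝ)) (X Y : ℝ) :
    eval2 (p :: Q) X Y = evalR p X + Y * eval2 Q X Y := rfl

/-- Coefficientwise sum. [folklore] -/
noncomputable def add2 : List (List ℝ) → List (List ℝ) → List (List ℝ)
  | [], Q => Q
  | p :: P, [] => p :: P
  | p :: P, q :: Q => addR p q :: add2 P Q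

/-- [folklore] -/
theorem eval2_add2 : ∀ (P Q : List (List ℝ)) (X Y : ℝ), eval2 (add2 P Q) X Y = eval2 P X Y + eval2 Q X Y
  | [], Q, X, Y => by simp [add2]
  | p :: P, [], X, Y => by simp [add2]
  | p :: P, q :: Q, X, Y => by
      rw [add2, eval2_cons, eval2_cons, eval2_cons, evalR_addR, eval2_add2 P Q X Y]; ring

/-- Scalar multiple. [folklore] -/
noncomputable def smul2 (c : ℝ) (Q : List (List ℝ)) : List (List ℝ) := Q.map (smulR c)

/-- [folklore] -/
theorem eval2_smul2 (c : ℝ) : ∀ (Q : List (List ℝ)) (X Y : ℝ), eval2 (smul2 c Q) X Y = c * eval2 Q X Y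
  | [], X, Y => by simp [smul2]
  | p :: Q, X, Y => by
      have h := eval2_smul2 c Q X Y
      simp only [smul2, List.map_cons] at h ⊢
      rw [eval2_cons, eval2_cons, evalR_smulR, h]; ring

/-- Multiplication by a polynomial in the first variable. [folklore] -/
noncomputable def mulInner2 (p : List ℝ) (Q : List (List ℝ)) : List (List ℝ) := Q.map (mulR p)

/-- [folklore] -/
theorem eval2_mulInner2 (p : List ℝ) : ∀ (Q : List (List ℝ)) (X Y : ℝ),
    eval2 (mulInner2 p Q) X Y = evalR p X * eval2 Q X Y
  | [], X, Y => by simp [mulInner2]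
  | q :: Q, X, Y => by
      have h := eval2_mulInner2 p Q X Y
      simp only [mulInner2, List.map_cons] at h ⊢
      rw [eval2_cons, eval2_cons, evalR_mulR, h]; ring

/-- Product: `(p + Y·P)·Q = p·Q + Y·(P·Q)`. [folklore] -/
noncomputable def mul2 : List (List ℝ) → List (List ℝ) → List (List ℝ)
  | [], _ => []
  | p :: P, Q => add2 (mulInner2 p Q) ([] :: mul2 P Q)

/-- [folklore] -/
theorem eval2_mul2 : ∀ (P Q : List (List ℝ)) (X Y : ℝ), eval2 (mul2 P Q) X Y = eval2 P X Y * eval2 Q X Y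
  | [], Q, X, Y => by simp [mul2]
  | p :: P, Q, X, Y => by
      rw [mul2, eval2_add2, eval2_mulInner2, eval2_cons, eval2_cons, evalR_nil, eval2_mul2 P Q X Y]; ring

/-- Prepending a zero to every row multiplies by the first variable. [folklore] -/
theorem eval2_map_cons_zero : ∀ (Q : List (List ℝ)) (X Y : ℝ),
    eval2 (Q.map fun l => ((0 : ℝ) :: l)) X Y = X * eval2 Q X Y
  | [], X, Y => by simp
  | q :: Q, X, Y => by
      have h := eval2_map_cons_zero Q X Y
      simp only [List.map_cons] at h ⊢
      rw [eval2_cons, eval2_cons, h, evalR_cons]; ring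

/-- One Horner step of `p(X + Y)`: `a + (X + Y)·Q`. [folklore] -/
noncomputable def shiftStep2 (a : ℝ) (Q : List (List ℝ)) : List (List ℝ) :=
  add2 [[a]] (add2 (Q.map fun l => ((0 : ℝ) :: l)) ([] :: Q))

/-- [folklore] -/
theorem eval2_shiftStep2 (a : ℝ) (Q : List (List ℝ)) (X Y : ℝ) :
    eval2 (shiftStep2 a Q) X Y = a + (X + Y) * eval2 Q X Y := by
  rw [shiftStep2, eval2_add2, eval2_add2, eval2_map_cons_zero, eval2_cons, eval2_cons, eval2_nil, evalR_nil]
  simp only [evalR_cons, evalR_nil]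
  ring

/-- `p(X + Y)` as a bivariate coefficient list. [folklore] -/
noncomputable def shift2 (as : List ℝ) : List (List ℝ) := as.foldr shiftStep2 []

/-- [folklore] -/
theorem eval2_shift2 (X Y : ℝ) : ∀ as : List ℝ, eval2 (shift2 as) X Y = evalR as (X + Y)
  | [] => by simp [shift2]
  | a :: as => by
      have h := eval2_shift2 X Y as
      simp only [shift2, List.foldr_cons] at h ⊢
      rw [eval2_shiftStep2, h, evalR_cons]

/-- `Y ↦ -Y`: alternate the signs of the rows. [folklore] -/
noncomputable def altY : List (List ℝ) → List (List ℝ)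
  | [] => []
  | p :: P => p :: smul2 (-1) (altY P)

/-- [folklore] -/
theorem eval2_altY (X Y : ℝ) : ∀ Q : List (List ℝ), eval2 (altY Q) X Y = eval2 Q X (-Y)
  | [] => by simp [altY]
  | p :: P => by rw [altY, eval2_cons, eval2_smul2, eval2_altY X Y P, eval2_cons]; ring

/-- Coefficientwise sum over a list of indices. [folklore] -/
noncomputable def sumList2 {ι : Type*} (l : List ι) (f : ι → List (List ℝ)) : List (List ℝ) :=
  l.foldr (fun i acc => add2 (f i) acc) []

/-- [folklore] -/
theorem eval2_sumList2 {ι : Type*} (f : ι → List (List ℝ)) (X Y : ℝ) :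
    ∀ l : List ι, eval2 (sumList2 l f) X Y = (l.map fun i => eval2 (f i) X Y).sum
  | [] => by simp [sumList2]
  | i :: l => by
      have h := eval2_sumList2 f X Y l
      simp only [sumList2, List.foldr_cons, List.map_cons, List.sum_cons] at h ⊢
      rw [eval2_add2, h]

/-- For a duplicate-free index list the value is the `Finset` sum over `l.toFinset`. [folklore] -/
theorem eval2_sumList2_toFinset {ι : Type*} [DecidableEq ι] (f : ι → List (List ℝ)) (X Y : ℝ)
    {l : List ι} (hl : l.Nodup) : eval2 (sumList2 l f) X Y = ∑ i ∈ l.toFinset, eval2 (f i) X Y := by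
  rw [eval2_sumList2, List.sum_toFinset _ hl]

/-- Coefficientwise sum over a `Finset`. [folklore] -/
noncomputable def finSum2 {ι : Type*} (S : Finset ι) (f : ι → List (List ℝ)) : List (List ℝ) :=
  sumList2 S.toList f

/-- [folklore] -/
theorem eval2_finSum2 {ι : Type*} (S : Finset ι) (f : ι → List (List ℝ)) (X Y : ℝ) :
    eval2 (finSum2 S f) X Y = ∑ i ∈ S, eval2 (f i) X Y := by
  rw [finSum2, eval2_sumList2, Finset.sum_map_toList]

/-! ### The kernel in the variables `(P, D) = (u + v - cc, u - v)` -/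

/-- The `(a,b)`-term of the kernel as a bivariate coefficient list in `(P, D)`:
`c 2^{a+b} (1 + σ(-1)^{a+b}) · p̂_a(P + D) · p̂_b(P - D)`, `p̂_a(t) = q¹(s, t/2 + cc/2; a)`. [folklore] -/
noncomputable def kernelPDRow (c : ℕ × ℕ → ℝ) (s σ cc : ℝ) (ab : ℕ × ℕ) : List (List ℝ) :=
  smul2 (c ab * 2 ^ (ab.1 + ab.2) * (1 + σ * (-1) ^ (ab.1 + ab.2)))
    (mul2 (shift2 (affineR (qFactor₁List s ab.1) (1 / 2) (cc / 2)))
      (altY (shift2 (affineR (qFactor₁List s ab.2) (1 / 2) (cc / 2)))))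

/-- [folklore] -/
theorem eval2_kernelPDRow (c : ℕ × ℕ → ℝ) (s σ cc : ℝ) (ab : ℕ × ℕ) (u v : ℝ) :
    eval2 (kernelPDRow c s σ cc ab) (u + v - cc) (u - v) = c ab * 2 ^ (ab.1 + ab.2) *
      (1 + σ * (-1) ^ (ab.1 + ab.2)) * (evalR (qFactor₁List s ab.1) u * evalR (qFactor₁List s ab.2) v) := by
  rw [kernelPDRow, eval2_smul2, eval2_mul2, eval2_shift2, eval2_altY, eval2_shift2, evalR_affineR,
    evalR_affineR]
  have hu : 1 / 2 * (u + v - cc + (u - v)) + cc / 2 = u := by ring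
  have hv : 1 / 2 * (u + v - cc + -(u - v)) + cc / 2 = v := by ring
  rw [hu, hv]

/-- The kernel over an index LIST `l` (a certificate's `S` as data; the shape an interval twin mirrors).
[folklore] -/
noncomputable def kernelPDL (c : ℕ × ℕ → ℝ) (l : List (ℕ × ℕ)) (s σ cc : ℝ) : List (List ℝ) :=
  sumList2 l (kernelPDRow c s σ cc)

/-- **`eval2 (kernelPDL c l …) (u + v - cc) (u - v) = K_c(u,v)`** for `S = l.toFinset` (`l` duplicate-free).
[folklore] -/
theorem eval2_kernelPDL (c : ℕ × ℕ → ℝ) {l : List (ℕ × ℕ)} (hl : l.Nodup) (s σ cc u v : ℝ) :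
    eval2 (kernelPDL c l s σ cc) (u + v - cc) (u - v) = evenKernel c l.toFinset s σ u v := by
  rw [kernelPDL, eval2_sumList2_toFinset _ _ _ hl, evenKernel_eq_sum_evalR]
  exact Finset.sum_congr rfl fun ab _ => eval2_kernelPDRow c s σ cc ab u v

/-- The kernel over any `Finset` (canonical shadow through `Finset.toList`). [folklore] -/
noncomputable def kernelPD (c : ℕ × ℕ → ℝ) (S : Finset (ℕ × ℕ)) (s σ cc : ℝ) : List (List ℝ) :=
  finSum2 S (kernelPDRow c s σ cc)

/-- **`K_c(u,v) = eval2 (kernelPD …) (u + v - cc) (u - v)`.** [folklore] -/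
theorem eval2_kernelPD (c : ℕ × ℕ → ℝ) (S : Finset (ℕ × ℕ)) (s σ cc u v : ℝ) :
    eval2 (kernelPD c S s σ cc) (u + v - cc) (u - v) = evenKernel c S s σ u v := by
  rw [kernelPD, eval2_finSum2, evenKernel_eq_sum_evalR]
  exact Finset.sum_congr rfl fun ab _ => eval2_kernelPDRow c s σ cc ab u v

/-! ### Reading off the monomial coefficients -/

/-- `evalR` as a finite sum padded to any length `N ≥ |as|`. [folklore] -/
theorem evalR_eq_sum_pad (as : List ℝ) {N : ℕ} (hN : as.length ≤ N) (x : ℝ) :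
    evalR as x = ∑ i ∈ range N, as.getD i 0 * x ^ i := by
  rw [evalR_eq_sum]
  refine Finset.sum_subset (range_subset_range.2 hN) fun i hi hi' => ?_
  have : as.length ≤ i := by
    simp only [mem_range, not_lt] at hi hi'
    exact hi'
  rw [List.getD_eq_default _ _ this, zero_mul]

/-- A common bound for the outer length and all row lengths. [folklore] -/
def size2 (Q : List (List ℝ)) : ℕ := Q.foldr (fun l n => max l.length n) Q.length

/-- [folklore] -/
theorem length_le_size2 (Q : List (List ℝ)) : Q.length ≤ size2 Q := by
  unfold size2
  generalize Q.length = n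
  induction Q with
  | nil => simp
  | cons q Q ih => simp only [List.foldr_cons]; exact le_max_of_le_right ih

/-- [folklore] -/
theorem length_le_size2_of_mem {Q : List (List ℝ)} {l : List ℝ} (hl : l ∈ Q) : l.length ≤ size2 Q := by
  unfold size2
  generalize Q.length = n
  induction Q with
  | nil => simp at hl
  | cons q Q ih =>
      simp only [List.foldr_cons]
      rcases List.mem_cons.mp hl with h | h
      · subst h; exact le_max_left _ _
      · exact le_max_of_le_right (ih h)

/-- Rows read through `getD`: the `k`-th entry of the row-evaluated list. [folklore] -/
theorem getD_map_evalR (X : ℝ) : ∀ (Q : List (List ℝ)) (k : ℕ),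
    (Q.map fun l => evalR l X).getD k 0 = evalR (Q.getD k []) X
  | [], k => by simp
  | q :: Q, 0 => by simp
  | q :: Q, k + 1 => by
      simp only [List.map_cons, List.getD_cons_succ]
      exact getD_map_evalR X Q k

/-- Every row (read through `getD`) is no longer than `size2`. [folklore] -/
theorem length_getD_le_size2 (Q : List (List ℝ)) (k : ℕ) : (Q.getD k []).length ≤ size2 Q := by
  by_cases hk : k < Q.length
  · have hmem : Q.getD k [] ∈ Q := by
      rw [List.getD_eq_getElem?_getD, List.getElem?_eq_getElem hk, Option.getD_some]
      exact List.getElem_mem hk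
    exact length_le_size2_of_mem hmem
  · rw [List.getD_eq_default _ _ (not_lt.mp hk)]
    exact Nat.zero_le _

/-- `eval2` as a double finite sum padded to a square `N × N`, `N ≥ size2`. [folklore] -/
theorem eval2_eq_sum_pad (Q : List (List ℝ)) {N : ℕ} (hN : size2 Q ≤ N) (X Y : ℝ) :
    eval2 Q X Y = ∑ k ∈ range N, ∑ m ∈ range N, (Q.getD k []).getD m 0 * X ^ m * Y ^ k := by
  have hlen : (Q.map fun l => evalR l X).length ≤ N := by
    rw [List.length_map]
    exact (length_le_size2 Q).trans hN
  rw [eval2, evalR_eq_sum_pad _ hlen]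
  refine Finset.sum_congr rfl fun k _ => ?_
  rw [getD_map_evalR, evalR_eq_sum_pad _ ((length_getD_le_size2 Q k).trans hN), Finset.sum_mul]

/-- Splitting a range of length `2N` into even and odd indices. [folklore] -/
theorem sum_range_two_mul (f : ℕ → ℝ) : ∀ N : ℕ,
    ∑ k ∈ range (2 * N), f k = ∑ i ∈ range N, f (2 * i) + ∑ i ∈ range N, f (2 * i + 1)
  | 0 => by simp
  | N + 1 => by
      rw [show 2 * (N + 1) = 2 * N + 1 + 1 by ring, Finset.sum_range_succ, Finset.sum_range_succ,
        sum_range_two_mul f N, Finset.sum_range_succ, Finset.sum_range_succ]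
      ring

/-- Entry `(k, m)` of a bivariate list read through `getD` (zero outside). [folklore] -/
def coeff2 (Q : List (List ℝ)) (m k : ℕ) : ℝ := (Q.getD k []).getD m 0

/-- **Core read-off.** If `eval2 Q (u+v-cc) (u-v) = K(u,v)` identically, then with `N = size2 Q`
`K(u,v) = Σ_{m,k<N} Q_{2k,m} (u+v-cc)^m (u-v)^{2k} + Σ_{m,k<N} Q_{2k+1,m} (u+v-cc)^m (u-v)^{2k+1}`. [folklore] -/
theorem sum_PD_of_eval2 (Q : List (List ℝ)) (K : ℝ → ℝ → ℝ) (cc : ℝ)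
    (hQ : ∀ u v : ℝ, eval2 Q (u + v - cc) (u - v) = K u v) (u v : ℝ) :
    K u v =
      ∑ mk ∈ range (size2 Q) ×ˢ range (size2 Q),
          coeff2 Q mk.1 (2 * mk.2) * ((u + v - cc) ^ mk.1 * (u - v) ^ (2 * mk.2)) +
        ∑ mk ∈ range (size2 Q) ×ˢ range (size2 Q),
          coeff2 Q mk.1 (2 * mk.2 + 1) * ((u + v - cc) ^ mk.1 * (u - v) ^ (2 * mk.2 + 1)) := by
  set N := size2 Q with hNdef
  have hsize : size2 Q ≤ 2 * N := by omega
  rw [← hQ, eval2_eq_sum_pad _ hsize, sum_range_two_mul, Finset.sum_product_right,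
    Finset.sum_product_right]
  -- the inner `m`-sums over `range (2N)` collapse to `range N` (entries beyond every row vanish)
  have hrow : ∀ k : ℕ, ∑ m ∈ range (2 * N), (Q.getD k []).getD m 0 * (u + v - cc) ^ m * (u - v) ^ k =
      ∑ m ∈ range N, coeff2 Q m k * ((u + v - cc) ^ m * (u - v) ^ k) := by
    intro k
    have hvan : ∀ m, N ≤ m → (Q.getD k []).getD m 0 = 0 := fun m hNm =>
      List.getD_eq_default _ _ (by have := length_getD_le_size2 Q k; omega)
    rw [eq_comm]
    refine (Finset.sum_congr rfl fun m _ => ?_).trans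
      (Finset.sum_subset (range_subset_range.2 (by omega : N ≤ 2 * N)) fun m hm hm' => ?_)
    · rw [coeff2]; ring
    · have hNm : N ≤ m := by simp only [mem_range, not_lt] at hm hm'; exact hm'
      rw [hvan m hNm, zero_mul, zero_mul]
  simp_rw [hrow]

/-- The coefficient of `P^m D^k` in `kernelPD` (any `Finset`). [folklore] -/
noncomputable def kernelPDCoeff (c : ℕ × ℕ → ℝ) (S : Finset (ℕ × ℕ)) (s σ cc : ℝ) (m k : ℕ) : ℝ :=
  coeff2 (kernelPD c S s σ cc) m k

/-- A size bound for the coefficient table of `kernelPD`. [folklore] -/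
noncomputable def kernelPDSize (c : ℕ × ℕ → ℝ) (S : Finset (ℕ × ℕ)) (s σ cc : ℝ) : ℕ :=
  size2 (kernelPD c S s σ cc)

/-- **The generic `(P, D)`-expansion of the kernel** (the hypothesis `hK` of `qSum_eq_sum_hMoment_of_kernel`,
for EVERY weight table and index set): with `N = kernelPDSize …`, `κ = kernelPDCoeff …`,
`K_c(u,v) = Σ_{m,k<N} κ(m,2k) (u+v-cc)^m (u-v)^{2k} + Σ_{m,k<N} κ(m,2k+1) (u+v-cc)^m (u-v)^{2k+1}`. [folklore] -/
theorem evenKernel_eq_sum_PD (c : ℕ × ℕ → ℝ) (S : Finset (ℕ × ℕ)) (s σ cc u v : ℝ) :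
    evenKernel c S s σ u v =
      ∑ mk ∈ range (kernelPDSize c S s σ cc) ×ˢ range (kernelPDSize c S s σ cc),
          kernelPDCoeff c S s σ cc mk.1 (2 * mk.2) * ((u + v - cc) ^ mk.1 * (u - v) ^ (2 * mk.2)) +
        ∑ mk ∈ range (kernelPDSize c S s σ cc) ×ˢ range (kernelPDSize c S s σ cc),
          kernelPDCoeff c S s σ cc mk.1 (2 * mk.2 + 1) * ((u + v - cc) ^ mk.1 * (u - v) ^ (2 * mk.2 + 1)) :=
  sum_PD_of_eval2 _ _ cc (eval2_kernelPD c S s σ cc) u v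

/-- **The `(E, h_k)` form of EVERY weighted q-sum, generically**: for all `c, S, s, σ, cc, E, j`,
`qSum c S s σ E j = Σ_{m,k<N} κ(m,2k) (E - cc)^m hMoment k j` (`κ = kernelPDCoeff`, `N = kernelPDSize`).
[folklore] -/
theorem qSum_eq_sum_hMoment_PD (c : ℕ × ℕ → ℝ) (S : Finset (ℕ × ℕ)) (s σ cc E : ℝ) (j : ℕ) :
    qSum c S s σ E j = ∑ mk ∈ range (kernelPDSize c S s σ cc) ×ˢ range (kernelPDSize c S s σ cc),
      kernelPDCoeff c S s σ cc mk.1 (2 * mk.2) * ((E - cc) ^ mk.1 * hMoment mk.2 j) :=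
  qSum_eq_sum_hMoment_of_kernel c S s σ cc _ _ (fun mk => kernelPDCoeff c S s σ cc mk.1 (2 * mk.2))
    (fun mk => kernelPDCoeff c S s σ cc mk.1 (2 * mk.2 + 1)) (fun u v => evenKernel_eq_sum_PD c S s σ cc u v) E j

/-- The same two statements over an index LIST `l` (`S = l.toFinset`, `l` duplicate-free), with the table
`coeff2 (kernelPDL c l s σ cc)` a reader recomputes by running the list algorithm. [folklore] -/
theorem evenKernel_eq_sum_PDL (c : ℕ × ℕ → ℝ) {l : List (ℕ × ℕ)} (hl : l.Nodup) (s σ cc u v : ℝ) :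
    evenKernel c l.toFinset s σ u v =
      ∑ mk ∈ range (size2 (kernelPDL c l s σ cc)) ×ˢ range (size2 (kernelPDL c l s σ cc)),
          coeff2 (kernelPDL c l s σ cc) mk.1 (2 * mk.2) * ((u + v - cc) ^ mk.1 * (u - v) ^ (2 * mk.2)) +
        ∑ mk ∈ range (size2 (kernelPDL c l s σ cc)) ×ˢ range (size2 (kernelPDL c l s σ cc)),
          coeff2 (kernelPDL c l s σ cc) mk.1 (2 * mk.2 + 1) *
            ((u + v - cc) ^ mk.1 * (u - v) ^ (2 * mk.2 + 1)) :=
  sum_PD_of_eval2 _ _ cc (eval2_kernelPDL c hl s σ cc) u v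

/-- [folklore] -/
theorem qSum_eq_sum_hMoment_PDL (c : ℕ × ℕ → ℝ) {l : List (ℕ × ℕ)} (hl : l.Nodup) (s σ cc E : ℝ) (j : ℕ) :
    qSum c l.toFinset s σ E j =
      ∑ mk ∈ range (size2 (kernelPDL c l s σ cc)) ×ˢ range (size2 (kernelPDL c l s σ cc)),
        coeff2 (kernelPDL c l s σ cc) mk.1 (2 * mk.2) * ((E - cc) ^ mk.1 * hMoment mk.2 j) :=
  qSum_eq_sum_hMoment_of_kernel c l.toFinset s σ cc _ _ (fun mk => coeff2 (kernelPDL c l s σ cc) mk.1 (2 * mk.2))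
    (fun mk => coeff2 (kernelPDL c l s σ cc) mk.1 (2 * mk.2 + 1)) (fun u v => evenKernel_eq_sum_PDL c hl s σ cc u v)
    E j

end Summit.CriticalPhenomena.Ising3D
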